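import Summits.BirchSwinnertonDyer.BirchSwinnertonDyer.Theorems.CyclotomicUntwistFormalEndomorphismPadicDigits
import Summits.BirchSwinnertonDyer.BirchSwinnertonDyer.Theorems.CyclotomicUntwistKatzRankSupersingular
import Summits.BirchSwinnertonDyer.BirchSwinnertonDyer.Theorems.CyclotomicUntwistNineRankTwoReduction
import HarnessLib

/-!
# Route `CyclotomicUntwist`: the named fact `WeierstrassCurve.isDescendedFrobeniusMatrix_exists` HOLDS —
# Berthelot–Ogus/Katz existence of the descended Frobenius matrix on every supersingular good model, now a THEOREM

Cell `pub/bsd-wall` (D-0145 line `route-BirchSwinnertonDyer-CyclotomicUntwist` rev 9), prover seat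
`bsd-line-cycu-p2` (gen 7). THEOREMS ONLY (no definition, no `sorry`); helper `--supports` K1 =
stmt-BirchSwinnertonDyer-21580 (print child C2 = 27549, whose second conjunct costs exactly this fact; K2 = 21581).
BSD is not proved by this file; no crux is; C2 itself keeps its Gross–Zagier–Kolyvagin conjunct `PublishedInputGZK`.

The Literature named fact `WeierstrassCurve.isDescendedFrobeniusMatrix_exists`
(`Literature/NumberTheory/EllipticCurves/DescendedFrobeniusMatrix.lean`, Berthelot–Ogus (2.4)/(3.14) + Katz 1981
Thm. 5.1.4/5.3.3/5.7.2/(6.1.1)) is DISCHARGED by composing the cell's elementary Katz-rank chain, every link of which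
is now in the tree:
* Honda's exponential form W1 (`KatzRankSupersingular.honda_step`, cycu-p3, over `SecondKindLog`);
* the digit expansion of `End_{𝔽_p⟦X⟧}(F̄)` and its `ℤ_p`-packaging — the binder `hDigAll` — this seat,
  `FormalEndomorphismPadicDigits.exists_digits_of_map_toZMod_hom` (p639042, p639885, p640419);
* cycu-p4's bridge, `p`-adic limit, base change `𝓞_{ℚ₃(ζ₉)} ← ℤ₃` and the registered-stub shape
  `KatzRankSupersingular.stub_KATZ_rankLeTwo_supersingular_of_digits : hDigAll → S2k`;
* cycu-p1/p5's reduction of the named fact to the supersingular rank statement S2k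
  (`NineRankTwoReduction.isDescendedFrobeniusMatrix_exists_of_katzRank_supersingular`: Galois descent of the
  ω-column, `[η]` of the second kind, unconditional independence of the classes).

* **`katzRankLeTwo_supersingular`** — the statement of the registered stub S2k (`stub_KATZ_rankLeTwo_supersingular`
  of `Lines/dfrob_wan.lean` / `Lines/dfrob_kato.lean`), as a theorem in this namespace (the by-name close in the
  crux namespace is cycu-p4's, lead ruling 2026-08-28T14:11Z): any three second-kind series for a Weierstrass model
  over `𝓞_{ℚ₃(ζ₉)}` with elliptic supersingular special fibre are `ℚ₃(ζ₉)`-dependent modulo bounded denominators;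
* **`isDescendedFrobeniusMatrix_exists_holds : WeierstrassCurve.isDescendedFrobeniusMatrix_exists`**.

References: [cite: Katz1981CrystallineDieudonne, Thm. 5.1.4, Thm. 5.3.3, Thm. 5.7.2, (6.1.1)];
[cite: BerthelotOgus1983, Thm. (2.4), Prop. (3.14)]; [cite: KatzMessing1974, Thm. 1]; [cite: SilvermanAEC2009, IV.7.4, V.2.3.1].
-/

set_option autoImplicit false
-- single-conjunct summit: `Summit.BirchSwinnertonDyer.BirchSwinnertonDyer.…` repeats the name by design
set_option linter.dupNamespace false

noncomputable section

open PowerSeries Literature.NumberTheory.EllipticCurves Literature.NumberTheory.EllipticCurves.DescendedFrobenius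

namespace Summit.BirchSwinnertonDyer.BirchSwinnertonDyer.Theorems.FormalEndomorphismPadicDigits

/-- **Katz 1981 Thm. 5.3.3 for the good models over `𝓞_{ℚ₃(ζ₉)}` with SUPERSINGULAR fibre** (the statement of the
registered stub S2k `stub_KATZ_rankLeTwo_supersingular`): any three second-kind series are `ℚ₃(ζ₉)`-dependent modulo
bounded denominators. Composition of cycu-p4's `stub_KATZ_rankLeTwo_supersingular_of_digits` with this seat's digit
datum `exists_digits_of_map_toZMod_hom`. [cite: Katz1981CrystallineDieudonne, Thm. 5.3.3] -/
theorem katzRankLeTwo_supersingular :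
    ∀ (E : WeierstrassCurve ONine) (ρ : ONine →+* ZMod 3), IsUnit (E.map ρ).Δ →
      (3 : ℤ) ∣ Literature.NumberTheory.EllipticCurves.HasseManin.tr (E.map ρ) →
      ∀ f : Fin 3 → KNine⟦X⟧,
        (∀ i, constantCoeff (f i) = 0 ∧
          (∃ d : ℕ, ∀ n : ℕ, IsIntegral ℤ_[3] ((3 : KNine) ^ d * ((n : KNine) * coeff n (f i)))) ∧
          (∃ d' : ℕ, ∀ e : Fin 2 →₀ ℕ, IsIntegral ℤ_[3] ((3 : KNine) ^ d' * MvPowerSeries.coeff e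
            ((f i).subst (E.map (algebraMap ONine KNine)).formalGroupLaw - (f i).subst (MvPowerSeries.X 0) -
              (f i).subst (MvPowerSeries.X 1))))) →
        ∃ a : Fin 3 → KNine, a ≠ 0 ∧ HasBoundedDenominators (∑ i, PowerSeries.C (a i) * f i) :=
  KatzRankSupersingular.stub_KATZ_rankLeTwo_supersingular_of_digits
    (fun V₀ _ _ hV₀ => exists_digits_of_map_toZMod_hom V₀ hV₀)

/-- **The named fact `WeierstrassCurve.isDescendedFrobeniusMatrix_exists` HOLDS**: for every `W/ℚ`, every good model
`𝓜` over `𝓞_{ℚ₃(ζ₉)}` and every reduction `ρ` with `3 ∣ 𝓜.specialFibreTrace ρ`, a descended Frobenius matrix with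
that trace exists. [cite: BerthelotOgus1983, Prop. (3.14)] [cite: Katz1981CrystallineDieudonne, Thm. 5.1.4, 5.3.3, 5.7.2 and (6.1.1)] -/
theorem isDescendedFrobeniusMatrix_exists_holds : WeierstrassCurve.isDescendedFrobeniusMatrix_exists :=
  NineRankTwoReduction.isDescendedFrobeniusMatrix_exists_of_katzRank_supersingular katzRankLeTwo_supersingular

end Summit.BirchSwinnertonDyer.BirchSwinnertonDyer.Theorems.FormalEndomorphismPadicDigits

end
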